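import Mathlib
import Literature.Barriers.PneNP.TSPExtensionComplexity
import Literature.Barriers.PneNP.ExtendedFormulationLinearImage
import Literature.Barriers.PneNP.CorrelationPolytopeXCLowerBound
import Literature.Combinatorics.Optimization.BlockPsdLiftFactorization
import Literature.Combinatorics.Optimization.CorrelationPolytopeGridMinor
import HarnessLib

/-!
# `xc(COR(K_h)) ≥ 1.5^h` in the graph currency `corPolytopeGraph ⊤`

The tree states the correlation polytope twice: `Literature.Combinatorics.Optimization.FixedSizePsdRank.corPolytope n
= conv{bbᵀ : b ∈ {0,1}ⁿ} ⊆ ℝ^{n·n}` (coordinates flattened by `finProdFinEquiv`,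
`BlockPsdLiftFactorization.lean`; the Kaibel–Weltge / FMPTW bound `corPolytope_xc_ge :
HasEFOfSize (corPolytope n) r → (3/2)ⁿ ≤ r + 1` lives there, `CorrelationPolytopeXCLowerBound.lean`), and the
correlation polytope OF A GRAPH `Literature.Combinatorics.Optimization.corPolytopeGraph G ⊆ ℝ^{V × V}`
(Aboulker–Fiorini–Huynh–Macchia–Seif, `CorrelationPolytopeGridMinor.lean`), whose complete-graph case
`corPolytopeGraph (⊤ : SimpleGraph (Fin n))` is the printed `COR(K_n)`.  Aboulker et al. close the proof of
their Theorem 6 with "since `K_h` is a minor of `K_{h,h}`, we have `xc(COR(K_h)) ≤ xc(COR(K_{h,h}))`.  In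
[KW15], it is shown that `xc(COR(K_h)) ≥ (1.5)^h`", i.e. they consume the Kaibel–Weltge bound AT THE GRAPH
`K_h`.  This file supplies exactly that hand-over, with no loss:

* `funCongrLeft_corVec_top` — reindexing `ℝ^{Fin n × Fin n} ≃ ℝ^{Fin (n·n)}` carries the vertex `corVec ⊤ b`
  of `COR(K_n)` to the vertex `bbᵀ` of `COR(n)` (because `b_i² = b_i` on `0/1` entries and every pair
  `i ≠ j` is an edge of `K_n`);
* `corPolytope_eq_image_corPolytopeGraph_top` — hence `COR(n)` is the image of `COR(K_n)` under that linear
  equivalence;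
* `hasEFOfSize_corPolytopeGraph_top_iff` — so the two have extended formulations of exactly the same sizes
  (`HasEFOfSize.image_linearEquiv_iff`);
* `corPolytopeGraph_top_three_pow_le`, `corPolytopeGraph_top_xc_ge` — `3^h ≤ (r+1)·2^h` and
  `(3/2)^h ≤ r + 1` for every size `r` of an extended formulation of `COR(K_h)`;
* `corPolytopeGraph_top_two_pow_half_le` — the same as a clean base-`2` exponential, `2^{h/2} ≤ r` once
  `h ≥ 4` (real exponent, the shape `2^{c·t} ≤ R` in which the grid-minor consumers
  (`AboulkerEtAl2019_corGridMinor`) spend it).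

All statements are proved; no definition, no named fact.

## References

* P. Aboulker, S. Fiorini, T. Huynh, M. Macchia, J. Seif, *Extension complexity of the correlation
  polytope*, Oper. Res. Lett. 47 (2019) 47–51 = arXiv:1806.00541, §1 (COR(G), p. 3) and the end of the proof
  of Thm. 6 (p. 6: "In [KW15], it is shown that xc(COR(K_h)) ≥ (1.5)^h").  Bib key `AboulkerEtAl2019`.
* V. Kaibel, S. Weltge, *A short proof that the extension complexity of the correlation polytope grows
  exponentially*, Discrete Comput. Geom. 53 (2015) 397–401 = arXiv:1307.3543, Thm. 1 and §3.  Bib key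
  `KaibelWeltge2014`.
* S. Fiorini, S. Massar, S. Pokutta, H. R. Tiwary, R. de Wolf, *Exponential lower bounds for polytopes in
  combinatorial optimization*, J. ACM 62 (2015) = arXiv:1111.0837, Thm. 7.  Bib key `FioriniEtAl2015`.
-/

noncomputable section

namespace Literature.Barriers.PneNP

open Matrix Finset
open Literature.Combinatorics.Optimization
open Literature.Combinatorics.Optimization.FixedSizePsdRank (Cube vecOuter bvec corPolytope)

/-- The coordinate change `ℝ^{Fin n × Fin n} ≃ₗ ℝ^{Fin (n·n)}` used throughout is Mathlib's
`LinearEquiv.funCongrLeft ℝ ℝ finProdFinEquiv.symm : x ↦ x ∘ finProdFinEquiv.symm` (flattening by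
`finProdFinEquiv`, the convention of `FixedSizePsdRank.vecOuter` / `flat`); it is spelled out rather than named
so that this file stays definition-free. [folklore] -/
private theorem funCongrLeft_finProdFinEquiv_symm_apply (n : ℕ) (x : Fin n × Fin n → ℝ) (p : Fin (n * n)) :
    LinearEquiv.funCongrLeft ℝ ℝ (finProdFinEquiv (m := n) (n := n)).symm x p =
      x (finProdFinEquiv.symm p) := rfl

/-- Flattening carries the vertex `corVec K_n b = (χ(X), χ(E(X)))` (`X = supp b`) of `COR(K_n)` to the
vertex `bbᵀ` of `COR(n)`: on the diagonal `b_i = b_i²`, off the diagonal every pair is an edge of `K_n` and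
`𝟙[b_i ∧ b_j] = b_i b_j`. [cite: AboulkerEtAl2019, §1 (p. 3: "x_{uv} = x_u x_v for all uv ∈ E(G)")] -/
theorem funCongrLeft_corVec_top (n : ℕ) (b : Cube n) :
    LinearEquiv.funCongrLeft ℝ ℝ (finProdFinEquiv (m := n) (n := n)).symm
      (corVec (⊤ : SimpleGraph (Fin n)) b) = vecOuter n (bvec b) := by
  funext p
  rw [funCongrLeft_finProdFinEquiv_symm_apply]
  unfold vecOuter
  rcases hq : finProdFinEquiv.symm p with ⟨i, j⟩
  simp only [bvec]
  by_cases hij : i = j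
  · subst hij
    rw [corVec_apply_diag]
    cases b i <;> simp
  · rw [corVec_apply_adj _ _ ((SimpleGraph.top_adj i j).2 hij)]
    cases b i <;> cases b j <;> simp

/-- `COR(n)` (flattened, `FixedSizePsdRank.corPolytope`) is the image of `COR(K_n)` (`corPolytopeGraph ⊤`)
under the flattening linear equivalence. [cite: AboulkerEtAl2019, §1 (p. 3)] -/
theorem corPolytope_eq_image_corPolytopeGraph_top (n : ℕ) :
    corPolytope n = LinearEquiv.funCongrLeft ℝ ℝ (finProdFinEquiv (m := n) (n := n)).symm ''
      corPolytopeGraph (⊤ : SimpleGraph (Fin n)) := by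
  have h : (LinearEquiv.funCongrLeft ℝ ℝ (finProdFinEquiv (m := n) (n := n)).symm :
        (Fin n × Fin n → ℝ) → (Fin (n * n) → ℝ)) '' corPolytopeGraph ⊤ =
      (LinearEquiv.funCongrLeft ℝ ℝ (finProdFinEquiv (m := n) (n := n)).symm).toLinearMap ''
        corPolytopeGraph (⊤ : SimpleGraph (Fin n)) := rfl
  rw [h, corPolytopeGraph, LinearMap.image_convexHull, ← Set.range_comp, corPolytope]
  congr 1
  ext x
  simp only [Set.mem_range, Function.comp_apply, LinearEquiv.coe_toLinearMap]
  constructor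
  · rintro ⟨b, rfl⟩
    exact ⟨b, funCongrLeft_corVec_top n b⟩
  · rintro ⟨b, rfl⟩
    exact ⟨b, (funCongrLeft_corVec_top n b).symm⟩

/-- **Extended formulations of `COR(K_n)` and of `COR(n)` have the same sizes** (the two encodings differ
by a linear change of coordinates, which is free in slack form). [cite: AboulkerEtAl2019, §1 (p. 3) with §2 (p. 5: "if π is an affine map, then xc(π(P)) ≤ xc(P)")] -/
theorem hasEFOfSize_corPolytopeGraph_top_iff (n r : ℕ) :
    HasEFOfSize (corPolytopeGraph (⊤ : SimpleGraph (Fin n))) r ↔ HasEFOfSize (corPolytope n) r := by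
  rw [corPolytope_eq_image_corPolytopeGraph_top, HasEFOfSize.image_linearEquiv_iff]

/-- **`xc(COR(K_h)) ≥ 1.5^h`, counting form**: an extended formulation of `COR(K_h)` with `r` inequalities
forces `3^h ≤ (r + 1)·2^h` (Kaibel–Weltge via `corPolytope_three_pow_le`).
[cite: KaibelWeltge2014, Thm. 1 and §3] [cite: AboulkerEtAl2019, proof of Thm. 6 (p. 6: "xc(COR(K_h)) ≥ (1.5)^h")] -/
theorem corPolytopeGraph_top_three_pow_le {h r : ℕ}
    (hyp : HasEFOfSize (corPolytopeGraph (⊤ : SimpleGraph (Fin h))) r) : 3 ^ h ≤ (r + 1) * 2 ^ h :=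
  corPolytope_three_pow_le ((hasEFOfSize_corPolytopeGraph_top_iff h r).1 hyp)

/-- **`xc(COR(K_h)) ≥ 1.5^h`**: `(3/2)^h ≤ r + 1` for every size `r` of an extended formulation of
`COR(K_h) = corPolytopeGraph ⊤`. [cite: KaibelWeltge2014, Thm. 1 and §3]
[cite: AboulkerEtAl2019, proof of Thm. 6 (p. 6: "In [KW15], it is shown that xc(COR(K_h)) ≥ (1.5)^h")] -/
theorem corPolytopeGraph_top_xc_ge {h r : ℕ}
    (hyp : HasEFOfSize (corPolytopeGraph (⊤ : SimpleGraph (Fin h))) r) : (3 / 2 : ℝ) ^ h ≤ r + 1 :=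
  corPolytope_xc_ge ((hasEFOfSize_corPolytopeGraph_top_iff h r).1 hyp)

/-- `(3/2)^h ≥ 2^{h/2} + 1` for `h ≥ 4` (`81/16 ≥ 5`, and the left side grows by the factor `3/2 ≥ √2`).
[folklore] -/
private theorem two_rpow_half_add_one_le (h : ℕ) (hh : 4 ≤ h) :
    (2 : ℝ) ^ ((h : ℝ) / 2) + 1 ≤ (3 / 2 : ℝ) ^ h := by
  induction h with
  | zero => omega
  | succ m ih =>
    rcases Nat.lt_or_ge m 4 with hm | hm
    · have hm3 : m = 3 := by omega
      subst hm3
      have h4 : ((3 + 1 : ℕ) : ℝ) / 2 = (2 : ℝ) := by norm_num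
      rw [h4, Real.rpow_two]
      norm_num
    · have ih' := ih hm
      have hsqrt : (2 : ℝ) ^ ((↑(m + 1) : ℝ) / 2) = 2 ^ ((m : ℝ) / 2) * 2 ^ ((1 : ℝ) / 2) := by
        rw [← Real.rpow_add (by norm_num : (0 : ℝ) < 2)]
        congr 1
        push_cast
        ring
      have hroot : (2 : ℝ) ^ ((1 : ℝ) / 2) ≤ 3 / 2 := by
        have h1 : (2 : ℝ) ^ ((1 : ℝ) / 2) = Real.sqrt 2 := by
          rw [Real.sqrt_eq_rpow]
        rw [h1, Real.sqrt_le_left (by norm_num)]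
        norm_num
      have hpos : (0 : ℝ) ≤ 2 ^ ((m : ℝ) / 2) := by positivity
      calc (2 : ℝ) ^ ((↑(m + 1) : ℝ) / 2) + 1
          = 2 ^ ((m : ℝ) / 2) * 2 ^ ((1 : ℝ) / 2) + 1 := by rw [hsqrt]
        _ ≤ 2 ^ ((m : ℝ) / 2) * (3 / 2) + 1 := by gcongr
        _ ≤ (2 ^ ((m : ℝ) / 2) + 1) * (3 / 2) := by linarith
        _ ≤ (3 / 2 : ℝ) ^ m * (3 / 2) := by gcongr
        _ = (3 / 2 : ℝ) ^ (m + 1) := by rw [pow_succ]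

/-- **Base-`2` form for the grid-minor consumers**: for `h ≥ 4`, every extended formulation of `COR(K_h)`
has at least `2^{h/2}` inequalities (real exponent; from `(3/2)^h ≤ r + 1` and `(3/2)^h ≥ 2^{h/2} + 1`).
[cite: KaibelWeltge2014, Thm. 1 and §3] [cite: AboulkerEtAl2019, proof of Thm. 6 (p. 6)] -/
theorem corPolytopeGraph_top_two_pow_half_le {h r : ℕ} (hh : 4 ≤ h)
    (hyp : HasEFOfSize (corPolytopeGraph (⊤ : SimpleGraph (Fin h))) r) :
    (2 : ℝ) ^ ((h : ℝ) / 2) ≤ r := by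
  have h1 := corPolytopeGraph_top_xc_ge hyp
  have h2 := two_rpow_half_add_one_le h hh
  linarith

end Literature.Barriers.PneNP

end
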